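import Summits.BirchSwinnertonDyer.BirchSwinnertonDyer.Theorems.AlignedTransportAtTwoMainConjectureTransportAlignedAtTwoKilfordCopyLevelRaisingParity
import Summits.BirchSwinnertonDyer.BirchSwinnertonDyer.Theorems.AlignedTransportAtTwoMainConjectureTransportAlignedAtTwoKilfordCopyCrossLevelShapes
import Summits.BirchSwinnertonDyer.BirchSwinnertonDyer.Theorems.AlignedTransportAtTwoMainConjectureTransportAlignedAtTwoKilfordCopyCrossLevelSemistable
import HarnessLib

/-!
# Crux C1 `MainConjectureTransportAlignedAtTwo` (stmt-BirchSwinnertonDyer-22296), line `birth`, residual (R2) `stub_lamLawKilford`, UNEQUAL conductors: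
# THE CROSS-LEVEL REDUCTIONS FROM PLANE(2) ALONE — the Kraus–Oesterlé hypothesis `hKO` of `…KilfordCopyCrossLevel{Shapes,SquarefreeConductor,Semistable}`
# DISCHARGED by `…KilfordCopyLevelRaisingParity` (width seat att-p3 g18; `--supports 22296`)

THEOREMS ONLY (no `def`, no `sorry`, no named fact). §1 proves the three `hKO` binder-form hypotheses verbatim (`hKO_conductorMul`, `hKO_conductorMulSquarefree`,
`hKO_semistableShape`): `q ≠ 2` because the curves are ordinary (good) at `2`, `a_q` of the curve multiplicative at `q` is odd from the conductor shape, and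
`…LevelRaisingParity.even_LFunction_of_sharedCubicField_of_odd_LFunction` gives the even parity on the good side. §2: the bodies of v27's inline cross-level
stub `hCopyNe` on the three conductor shapes (`N(W₂) = N(W₁)·q`; `N(W₂) = N(W₁)·m`, `m` squarefree; `N(Wᵢ) = N₀·mᵢ` two-sided — every semistable pair) from the
SINGLE hypothesis `hPlane` = PLANE(2) at the intermediate / common level for the old line(s) (att-p5 g18's fourth engine: aligned ⟹ same plane 110/110 + 7/7
+ 2/2, misaligned ⟹ planes meet in `0` 255/255 + 15/15 + 7/7; att-p4 g17's `…KilfordKernelLetterCrossLevel` is its kernel-letter consumer at that level).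

BSD is not proved by this; C1 is not closed by this; `hPlane` (H12♯-shaped, level `N₂` / `L`) remains the ONE cross-level input of (R2) on these shapes.

References: Kraus–Oesterlé 1992 Prop. 3 [KrausOesterle1992]; Greenberg–Vatsal 2000 §3 [GreenbergVatsal2000]; Cremona 1997 §2.4, §2.10 [CremonaAlgorithms1997].
-/

noncomputable section

-- justification: the `Summit.BirchSwinnertonDyer.BirchSwinnertonDyer.…` path repeats a component (route-file convention)
set_option linter.dupNamespace false
set_option autoImplicit false

open scoped MatrixGroups ModularForm Classical

open CongruenceSubgroup Complex WeierstrassCurve IsDedekindDomain Polynomial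
open Literature.NumberTheory.EllipticCurves Literature.NumberTheory.EllipticCurves.ModularForms
open Literature.NumberTheory.EllipticCurves.Greenberg1999
open Summit.BirchSwinnertonDyer.Rank1Residual.F1Sign2
open Summit.BirchSwinnertonDyer.BirchSwinnertonDyer.Theorems.AlignedTransportAtTwoKilfordCopyCrossLevel (odd_LFunction_of_conductorNorm_eq_mul)
open Summit.BirchSwinnertonDyer.BirchSwinnertonDyer.Theorems.AlignedTransportAtTwoKilfordCopyCrossLevelShapes (sameDepletedKernel_conductorMul_of_oldLinePlane)
open Summit.BirchSwinnertonDyer.BirchSwinnertonDyer.Theorems.AlignedTransportAtTwoKilfordCopyCrossLevelSquarefreeConductor (odd_LFunction_of_dvd_conductorNorm_eq_mul sameDepletedKernel_conductorMulSquarefree_of_oldLinesPlane)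
open Summit.BirchSwinnertonDyer.BirchSwinnertonDyer.Theorems.AlignedTransportAtTwoKilfordCopyCrossLevelSemistable (sameDepletedKernel_semistableShape_of_twoOldLinesPlane)
open Summit.BirchSwinnertonDyer.BirchSwinnertonDyer.Theorems.AlignedTransportAtTwoKilfordCopyLevelRaisingParity

namespace Summit.BirchSwinnertonDyer.BirchSwinnertonDyer.Theorems.AlignedTransportAtTwoKilfordCopyCrossLevelPlaneOnly

/-! ## §1 The three `hKO` hypotheses, proved -/

/-- A prime of a squarefree product `∏_{q∈Q} q` divides it exactly once. [folklore] -/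
theorem not_sq_dvd_prod_of_mem (Q : Finset ℕ) (hQ : ∀ q ∈ Q, q.Prime) {q : ℕ} (hq : q ∈ Q) : ¬ q ^ 2 ∣ ∏ q' ∈ Q, q' := by
  classical
  intro h
  rw [← Finset.mul_prod_erase Q (fun q' ↦ q') hq, pow_two] at h
  obtain ⟨q', hq', hqq'⟩ := (Prime.dvd_finsetProd_iff (hQ q hq).prime _).mp (Nat.dvd_of_mul_dvd_mul_left (hQ q hq).pos h)
  exact Finset.ne_of_mem_erase hq' (((Nat.prime_dvd_prime_iff_eq (hQ q hq) (hQ q' (Finset.mem_of_mem_erase hq'))).mp hqq').symm)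

/-- A prime outside `Q` does not divide `∏_{q∈Q} q` (primes `Q`). [folklore] -/
theorem not_dvd_prod_of_not_mem (Q : Finset ℕ) (hQ : ∀ q ∈ Q, q.Prime) {ℓ : ℕ} (hℓ : ℓ.Prime) (hℓQ : ℓ ∉ Q) : ¬ ℓ ∣ ∏ q ∈ Q, q := by
  intro h
  obtain ⟨q, hq, hℓq⟩ := (Prime.dvd_finsetProd_iff hℓ.prime _).mp h
  exact hℓQ (((Nat.prime_dvd_prime_iff_eq hℓ (hQ q hq)).mp hℓq) ▸ hq)

/-- **`hKO` on the shape `N(W₂) = N(W₁)·q`, PROVED** (the hypothesis of `…CrossLevelShapes.sameDepletedKernel_conductorMul_of_oldLinePlane` verbatim).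
[cite: KrausOesterle1992, Prop. 3 (p. 262–263)] -/
theorem hKO_conductorMul : ∀ (W₁ : WeierstrassCurve ℚ) [W₁.IsElliptic] [W₁.IsGloballyMinimal]
      (W₂ : WeierstrassCurve ℚ) [W₂.IsElliptic] [W₂.IsGloballyMinimal],
      IsOrdinaryAt W₁ 2 → IsOrdinaryAt W₂ 2 →
      (∀ x : ℚ, ¬ HasRationalTwoTorsionX W₁ x) → (∀ x : ℚ, ¬ HasRationalTwoTorsionX W₂ x) →
      ¬ IsSquare W₁.Δ → ¬ IsSquare W₂.Δ →
      ∀ (q : ℕ), q.Prime → ¬ q ∣ W₁.conductorNorm ℤ → W₂.conductorNorm ℤ = W₁.conductorNorm ℤ * q →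
      ∀ (F : Type) [Field F] [NumberField F], Module.finrank ℚ F = 3 →
      ∀ e₁ e₂ : F, aeval e₁ (twoDivisionUCubic W₁) = 0 → aeval e₂ (twoDivisionUCubic W₂) = 0 →
      Even (W₁.LFunction q) := by
  intro W₁ _ _ W₂ _ _ _ hord₂ _ ht₂ _ _ q hq hqN₁ hN₂ F _ _ hF e₁ e₂ he₁ he₂
  have hqN₂ : q ∣ W₂.conductorNorm ℤ := by rw [hN₂]; exact Dvd.intro_left _ rfl
  exact even_LFunction_of_sharedCubicField_of_odd_LFunction W₁ W₂ hF ht₂ he₁ he₂ hq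
    (ne_two_of_dvd_conductorNorm_of_isOrdinaryAt W₂ hord₂ hqN₂) hqN₁ hqN₂ (odd_LFunction_of_conductorNorm_eq_mul W₂ hq hqN₁ hN₂)

/-- **`hKO` on the shape `N(W₂) = N(W₁)·∏_{q∈Q} q`, PROVED** (the hypothesis of `…SquarefreeConductor.sameDepletedKernel_conductorMulSquarefree_of_oldLinesPlane`
verbatim). [cite: KrausOesterle1992, Prop. 3 (p. 262–263)] -/
theorem hKO_conductorMulSquarefree : ∀ (W₁ : WeierstrassCurve ℚ) [W₁.IsElliptic] [W₁.IsGloballyMinimal]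
      (W₂ : WeierstrassCurve ℚ) [W₂.IsElliptic] [W₂.IsGloballyMinimal],
      IsOrdinaryAt W₁ 2 → IsOrdinaryAt W₂ 2 →
      (∀ x : ℚ, ¬ HasRationalTwoTorsionX W₁ x) → (∀ x : ℚ, ¬ HasRationalTwoTorsionX W₂ x) →
      ¬ IsSquare W₁.Δ → ¬ IsSquare W₂.Δ →
      ∀ (Q : Finset ℕ), (∀ q ∈ Q, q.Prime) → (∀ q ∈ Q, ¬ q ∣ W₁.conductorNorm ℤ) → W₂.conductorNorm ℤ = W₁.conductorNorm ℤ * ∏ q ∈ Q, q →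
      ∀ (F : Type) [Field F] [NumberField F], Module.finrank ℚ F = 3 →
      ∀ e₁ e₂ : F, aeval e₁ (twoDivisionUCubic W₁) = 0 → aeval e₂ (twoDivisionUCubic W₂) = 0 →
      ∀ q ∈ Q, Even (W₁.LFunction q) := by
  intro W₁ _ _ W₂ _ _ _ hord₂ _ ht₂ _ _ Q hQ hQN₁ hN₂ F _ _ hF e₁ e₂ he₁ he₂ q hq
  have hqN₂ : q ∣ W₂.conductorNorm ℤ := by rw [hN₂]; exact (Finset.dvd_prod_of_mem _ hq).mul_left _
  exact even_LFunction_of_sharedCubicField_of_odd_LFunction W₁ W₂ hF ht₂ he₁ he₂ (hQ q hq)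
    (ne_two_of_dvd_conductorNorm_of_isOrdinaryAt W₂ hord₂ hqN₂) (hQN₁ q hq) hqN₂
    (odd_LFunction_of_dvd_conductorNorm_eq_mul W₂ (hQ q hq) (hQN₁ q hq) (Finset.dvd_prod_of_mem _ hq) (not_sq_dvd_prod_of_mem Q hQ hq) hN₂)

/-- **`hKO` on the two-sided shape `N(W₁) = N₀·∏Q₁`, `N(W₂) = N₀·∏Q₂`, PROVED** (the hypothesis of
`…CrossLevelSemistable.sameDepletedKernel_semistableShape_of_twoOldLinesPlane` verbatim; the `Q₁`-half is the `Q₂`-half with the curves exchanged).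
[cite: KrausOesterle1992, Prop. 3 (p. 262–263)] -/
theorem hKO_semistableShape : ∀ (W₁ : WeierstrassCurve ℚ) [W₁.IsElliptic] [W₁.IsGloballyMinimal]
      (W₂ : WeierstrassCurve ℚ) [W₂.IsElliptic] [W₂.IsGloballyMinimal],
      IsOrdinaryAt W₁ 2 → IsOrdinaryAt W₂ 2 →
      (∀ x : ℚ, ¬ HasRationalTwoTorsionX W₁ x) → (∀ x : ℚ, ¬ HasRationalTwoTorsionX W₂ x) →
      ¬ IsSquare W₁.Δ → ¬ IsSquare W₂.Δ →
      ∀ (N₀ : ℕ) (Q₁ Q₂ : Finset ℕ), (∀ q ∈ Q₁, q.Prime) → (∀ q ∈ Q₂, q.Prime) → Disjoint Q₁ Q₂ →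
        (∀ q ∈ Q₁, ¬ q ∣ N₀) → (∀ q ∈ Q₂, ¬ q ∣ N₀) →
        W₁.conductorNorm ℤ = N₀ * ∏ q ∈ Q₁, q → W₂.conductorNorm ℤ = N₀ * ∏ q ∈ Q₂, q →
      ∀ (F : Type) [Field F] [NumberField F], Module.finrank ℚ F = 3 →
      ∀ e₁ e₂ : F, aeval e₁ (twoDivisionUCubic W₁) = 0 → aeval e₂ (twoDivisionUCubic W₂) = 0 →
      (∀ q ∈ Q₂, Even (W₁.LFunction q)) ∧ (∀ q ∈ Q₁, Even (W₂.LFunction q)) := by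
  intro W₁ _ _ W₂ _ _ hord₁ hord₂ ht₁ ht₂ _ _ N₀ Q₁ Q₂ hQ₁ hQ₂ hdisj hQ₁N₀ hQ₂N₀ hN₁ hN₂ F _ _ hF e₁ e₂ he₁ he₂
  have hQ₁N₂ : ∀ q ∈ Q₁, ¬ q ∣ W₂.conductorNorm ℤ := by
    intro q hq h
    rw [hN₂] at h
    rcases (Nat.Prime.dvd_mul (hQ₁ q hq)).mp h with h | h
    · exact hQ₁N₀ q hq h
    · exact not_dvd_prod_of_not_mem Q₂ hQ₂ (hQ₁ q hq) (Finset.disjoint_left.mp hdisj hq) h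
  have hQ₂N₁ : ∀ q ∈ Q₂, ¬ q ∣ W₁.conductorNorm ℤ := by
    intro q hq h
    rw [hN₁] at h
    rcases (Nat.Prime.dvd_mul (hQ₂ q hq)).mp h with h | h
    · exact hQ₂N₀ q hq h
    · exact not_dvd_prod_of_not_mem Q₁ hQ₁ (hQ₂ q hq) (Finset.disjoint_right.mp hdisj hq) h
  refine ⟨fun q hq ↦ ?_, fun q hq ↦ ?_⟩
  · have hqN₂ : q ∣ W₂.conductorNorm ℤ := by rw [hN₂]; exact (Finset.dvd_prod_of_mem _ hq).mul_left _
    exact even_LFunction_of_sharedCubicField_of_odd_LFunction W₁ W₂ hF ht₂ he₁ he₂ (hQ₂ q hq)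
      (ne_two_of_dvd_conductorNorm_of_isOrdinaryAt W₂ hord₂ hqN₂) (hQ₂N₁ q hq) hqN₂
      (odd_LFunction_of_dvd_conductorNorm_eq_mul W₂ (hQ₂ q hq) (hQ₂N₀ q hq) (Finset.dvd_prod_of_mem _ hq) (not_sq_dvd_prod_of_mem Q₂ hQ₂ hq) hN₂)
  · have hqN₁ : q ∣ W₁.conductorNorm ℤ := by rw [hN₁]; exact (Finset.dvd_prod_of_mem _ hq).mul_left _
    exact even_LFunction_of_sharedCubicField_of_odd_LFunction W₂ W₁ hF ht₁ he₂ he₁ (hQ₁ q hq)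
      (ne_two_of_dvd_conductorNorm_of_isOrdinaryAt W₁ hord₁ hqN₁) (hQ₁N₂ q hq) hqN₁
      (odd_LFunction_of_dvd_conductorNorm_eq_mul W₁ (hQ₁ q hq) (hQ₁N₀ q hq) (Finset.dvd_prod_of_mem _ hq) (not_sq_dvd_prod_of_mem Q₁ hQ₁ hq) hN₁)

/-! ## §2 The cross-level stub bodies from PLANE(2) alone -/

/-- **v27's inline cross-level stub `hCopyNe` on the shape `N(W₂) = N(W₁)·q` FROM `hPlane` ALONE** (PLANE(2) at level `N(W₂)` for the `q`-old line of
`f₁` against `f₂`; the Kraus–Oesterlé parity is now a theorem). [cite: GreenbergVatsal2000, §3] [cite: KrausOesterle1992, Prop. 3 (p. 262–263)] -/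
theorem sameDepletedKernel_conductorMul_of_oldLinePlane'
    (hPlane : ∀ (W₁ : WeierstrassCurve ℚ) [W₁.IsElliptic] [W₁.IsGloballyMinimal]
      (W₂ : WeierstrassCurve ℚ) [W₂.IsElliptic] [W₂.IsGloballyMinimal],
      IsOrdinaryAt W₁ 2 → IsOrdinaryAt W₂ 2 →
      (∀ x : ℚ, ¬ HasRationalTwoTorsionX W₁ x) → (∀ x : ℚ, ¬ HasRationalTwoTorsionX W₂ x) →
      ¬ IsSquare W₁.Δ → ¬ IsSquare W₂.Δ →
      (¬ ∃ (d : ℚ) (c : WeierstrassCurve.VariableChange ℚ), c • W₁.quadraticTwist d = W₂) →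
      OnKilfordStratumAtTwo W₁ →
      ∀ (q : ℕ), q.Prime → ¬ q ∣ W₁.conductorNorm ℤ → W₂.conductorNorm ℤ = W₁.conductorNorm ℤ * q →
      ∀ (F : Type) [Field F] [NumberField F], Module.finrank ℚ F = 3 →
      ∀ e₁ e₂ : F, aeval e₁ (twoDivisionUCubic W₁) = 0 → aeval e₂ (twoDivisionUCubic W₂) = 0 →
      AlignedAtTwo F e₁ e₂ → AlignedAtInfinity F (twoDivisionUCubic W₁) (twoDivisionUCubic W₂) e₁ e₂ →
      ∀ [NeZero (W₁.conductorNorm ℤ)] [NeZero (W₂.conductorNorm ℤ)]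
        (D₁ : ModularParametrizationData W₁ (W₁.conductorNorm ℤ)) (D₂ : ModularParametrizationData W₂ (W₂.conductorNorm ℤ)),
        Odd D₁.c → Odd D₂.c →
      ∀ (F₁ : CuspForm (Gamma0 (W₂.conductorNorm ℤ)) 2),
        (∀ n : ℕ, cuspCoeff F₁ n = cuspCoeff D₁.f n + (q : ℂ) * (if q ∣ n then cuspCoeff D₁.f (n / q) else 0)) →
      ∀ y ∈ periodHomology (W₂.conductorNorm ℤ),
        D₁.uniformize ((D₁.c : ℂ) * y F₁ / 2) = 0 ↔ D₂.uniformize ((D₂.c : ℂ) * y D₂.f / 2) = 0) :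
    ∀ (W₁ : WeierstrassCurve ℚ) [W₁.IsElliptic] [W₁.IsGloballyMinimal]
      (W₂ : WeierstrassCurve ℚ) [W₂.IsElliptic] [W₂.IsGloballyMinimal],
      IsOrdinaryAt W₁ 2 → IsOrdinaryAt W₂ 2 →
      (∀ x : ℚ, ¬ HasRationalTwoTorsionX W₁ x) → (∀ x : ℚ, ¬ HasRationalTwoTorsionX W₂ x) →
      ¬ IsSquare W₁.Δ → ¬ IsSquare W₂.Δ →
      (¬ ∃ (d : ℚ) (c : WeierstrassCurve.VariableChange ℚ), c • W₁.quadraticTwist d = W₂) →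
      OnKilfordStratumAtTwo W₁ →
      ∀ (q : ℕ), q.Prime → ¬ q ∣ W₁.conductorNorm ℤ → W₂.conductorNorm ℤ = W₁.conductorNorm ℤ * q →
      ∀ (F : Type) [Field F] [NumberField F], Module.finrank ℚ F = 3 →
      ∀ e₁ e₂ : F, aeval e₁ (twoDivisionUCubic W₁) = 0 → aeval e₂ (twoDivisionUCubic W₂) = 0 →
      AlignedAtTwo F e₁ e₂ → AlignedAtInfinity F (twoDivisionUCubic W₁) (twoDivisionUCubic W₂) e₁ e₂ →
      ∀ [NeZero (W₁.conductorNorm ℤ)] [NeZero (W₂.conductorNorm ℤ)]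
        (D₁ : ModularParametrizationData W₁ (W₁.conductorNorm ℤ)) (D₂ : ModularParametrizationData W₂ (W₂.conductorNorm ℤ)),
        Odd D₁.c → Odd D₂.c →
      ∀ (N' : ℕ) [NeZero N'], N' = W₁.conductorNorm ℤ * W₂.conductorNorm ℤ *
          ∏ ℓ ∈ (W₁.conductorNorm ℤ * W₂.conductorNorm ℤ).primeFactors.erase 2, ℓ ^ 2 →
      ∀ (g₁ g₂ : CuspForm (Gamma0 N') 2),
        (∀ n : ℕ, cuspCoeff g₁ n =
          if ∃ ℓ ∈ (W₁.conductorNorm ℤ * W₂.conductorNorm ℤ).primeFactors.erase 2, ℓ ∣ n then 0 else cuspCoeff D₁.f n) →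
        (∀ n : ℕ, cuspCoeff g₂ n =
          if ∃ ℓ ∈ (W₁.conductorNorm ℤ * W₂.conductorNorm ℤ).primeFactors.erase 2, ℓ ∣ n then 0 else cuspCoeff D₂.f n) →
      ∀ x ∈ periodHomology N',
        D₁.uniformize ((D₁.c : ℂ) *
            ((((∏ ℓ ∈ (W₁.conductorNorm ℤ * W₂.conductorNorm ℤ).primeFactors.erase 2, ℓ ^ 2 : ℕ) : ℂ) * x g₁) / 2)) = 0 ↔
          D₂.uniformize ((D₂.c : ℂ) *
            ((((∏ ℓ ∈ (W₁.conductorNorm ℤ * W₂.conductorNorm ℤ).primeFactors.erase 2, ℓ ^ 2 : ℕ) : ℂ) * x g₂) / 2)) = 0 :=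
  sameDepletedKernel_conductorMul_of_oldLinePlane hPlane hKO_conductorMul

/-- **`hCopyNe` on the shape `N(W₂) = N(W₁)·∏_{q∈Q} q` (squarefree ratio) FROM `hPlane` ALONE** (PLANE(2) at level `N(W₂)` for the `m`-old line).
[cite: GreenbergVatsal2000, §3] [cite: KrausOesterle1992, Prop. 3 (p. 262–263)] -/
theorem sameDepletedKernel_conductorMulSquarefree_of_oldLinesPlane'
    (hPlane : ∀ (W₁ : WeierstrassCurve ℚ) [W₁.IsElliptic] [W₁.IsGloballyMinimal]
      (W₂ : WeierstrassCurve ℚ) [W₂.IsElliptic] [W₂.IsGloballyMinimal],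
      IsOrdinaryAt W₁ 2 → IsOrdinaryAt W₂ 2 →
      (∀ x : ℚ, ¬ HasRationalTwoTorsionX W₁ x) → (∀ x : ℚ, ¬ HasRationalTwoTorsionX W₂ x) →
      ¬ IsSquare W₁.Δ → ¬ IsSquare W₂.Δ →
      (¬ ∃ (d : ℚ) (c : WeierstrassCurve.VariableChange ℚ), c • W₁.quadraticTwist d = W₂) →
      OnKilfordStratumAtTwo W₁ →
      ∀ (Q : Finset ℕ), (∀ q ∈ Q, q.Prime) → (∀ q ∈ Q, ¬ q ∣ W₁.conductorNorm ℤ) → W₂.conductorNorm ℤ = W₁.conductorNorm ℤ * ∏ q ∈ Q, q →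
      ∀ (F : Type) [Field F] [NumberField F], Module.finrank ℚ F = 3 →
      ∀ e₁ e₂ : F, aeval e₁ (twoDivisionUCubic W₁) = 0 → aeval e₂ (twoDivisionUCubic W₂) = 0 →
      AlignedAtTwo F e₁ e₂ → AlignedAtInfinity F (twoDivisionUCubic W₁) (twoDivisionUCubic W₂) e₁ e₂ →
      ∀ [NeZero (W₁.conductorNorm ℤ)] [NeZero (W₂.conductorNorm ℤ)]
        (D₁ : ModularParametrizationData W₁ (W₁.conductorNorm ℤ)) (D₂ : ModularParametrizationData W₂ (W₂.conductorNorm ℤ)),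
        Odd D₁.c → Odd D₂.c →
      ∀ (F₁ : CuspForm (Gamma0 (W₂.conductorNorm ℤ)) 2),
        (∀ n : ℕ, cuspCoeff F₁ n =
          ∑ T ∈ Q.powerset, ((∏ q ∈ T, q : ℕ) : ℂ) * (if (∏ q ∈ T, q) ∣ n then cuspCoeff D₁.f (n / ∏ q ∈ T, q) else 0)) →
      ∀ y ∈ periodHomology (W₂.conductorNorm ℤ),
        D₁.uniformize ((D₁.c : ℂ) * y F₁ / 2) = 0 ↔ D₂.uniformize ((D₂.c : ℂ) * y D₂.f / 2) = 0) :
    ∀ (W₁ : WeierstrassCurve ℚ) [W₁.IsElliptic] [W₁.IsGloballyMinimal]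
      (W₂ : WeierstrassCurve ℚ) [W₂.IsElliptic] [W₂.IsGloballyMinimal],
      IsOrdinaryAt W₁ 2 → IsOrdinaryAt W₂ 2 →
      (∀ x : ℚ, ¬ HasRationalTwoTorsionX W₁ x) → (∀ x : ℚ, ¬ HasRationalTwoTorsionX W₂ x) →
      ¬ IsSquare W₁.Δ → ¬ IsSquare W₂.Δ →
      (¬ ∃ (d : ℚ) (c : WeierstrassCurve.VariableChange ℚ), c • W₁.quadraticTwist d = W₂) →
      OnKilfordStratumAtTwo W₁ →
      ∀ (Q : Finset ℕ), (∀ q ∈ Q, q.Prime) → (∀ q ∈ Q, ¬ q ∣ W₁.conductorNorm ℤ) → W₂.conductorNorm ℤ = W₁.conductorNorm ℤ * ∏ q ∈ Q, q →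
      ∀ (F : Type) [Field F] [NumberField F], Module.finrank ℚ F = 3 →
      ∀ e₁ e₂ : F, aeval e₁ (twoDivisionUCubic W₁) = 0 → aeval e₂ (twoDivisionUCubic W₂) = 0 →
      AlignedAtTwo F e₁ e₂ → AlignedAtInfinity F (twoDivisionUCubic W₁) (twoDivisionUCubic W₂) e₁ e₂ →
      ∀ [NeZero (W₁.conductorNorm ℤ)] [NeZero (W₂.conductorNorm ℤ)]
        (D₁ : ModularParametrizationData W₁ (W₁.conductorNorm ℤ)) (D₂ : ModularParametrizationData W₂ (W₂.conductorNorm ℤ)),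
        Odd D₁.c → Odd D₂.c →
      ∀ (N' : ℕ) [NeZero N'], N' = W₁.conductorNorm ℤ * W₂.conductorNorm ℤ *
          ∏ ℓ ∈ (W₁.conductorNorm ℤ * W₂.conductorNorm ℤ).primeFactors.erase 2, ℓ ^ 2 →
      ∀ (g₁ g₂ : CuspForm (Gamma0 N') 2),
        (∀ n : ℕ, cuspCoeff g₁ n =
          if ∃ ℓ ∈ (W₁.conductorNorm ℤ * W₂.conductorNorm ℤ).primeFactors.erase 2, ℓ ∣ n then 0 else cuspCoeff D₁.f n) →
        (∀ n : ℕ, cuspCoeff g₂ n =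
          if ∃ ℓ ∈ (W₁.conductorNorm ℤ * W₂.conductorNorm ℤ).primeFactors.erase 2, ℓ ∣ n then 0 else cuspCoeff D₂.f n) →
      ∀ x ∈ periodHomology N',
        D₁.uniformize ((D₁.c : ℂ) *
            ((((∏ ℓ ∈ (W₁.conductorNorm ℤ * W₂.conductorNorm ℤ).primeFactors.erase 2, ℓ ^ 2 : ℕ) : ℂ) * x g₁) / 2)) = 0 ↔
          D₂.uniformize ((D₂.c : ℂ) *
            ((((∏ ℓ ∈ (W₁.conductorNorm ℤ * W₂.conductorNorm ℤ).primeFactors.erase 2, ℓ ^ 2 : ℕ) : ℂ) * x g₂) / 2)) = 0 :=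
  sameDepletedKernel_conductorMulSquarefree_of_oldLinesPlane hPlane hKO_conductorMulSquarefree

/-- **`hCopyNe` on the two-sided shape `N(W₁) = N₀·∏Q₁`, `N(W₂) = N₀·∏Q₂` — every pair of semistable curves on the stratum — FROM `hPlane` ALONE**
(PLANE(2) at the common level `L = N(W₁)·∏Q₂` for the two old lines). [cite: GreenbergVatsal2000, §3] [cite: KrausOesterle1992, Prop. 3 (p. 262–263)] -/
theorem sameDepletedKernel_semistableShape_of_twoOldLinesPlane'
    (hPlane : ∀ (W₁ : WeierstrassCurve ℚ) [W₁.IsElliptic] [W₁.IsGloballyMinimal]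
      (W₂ : WeierstrassCurve ℚ) [W₂.IsElliptic] [W₂.IsGloballyMinimal],
      IsOrdinaryAt W₁ 2 → IsOrdinaryAt W₂ 2 →
      (∀ x : ℚ, ¬ HasRationalTwoTorsionX W₁ x) → (∀ x : ℚ, ¬ HasRationalTwoTorsionX W₂ x) →
      ¬ IsSquare W₁.Δ → ¬ IsSquare W₂.Δ →
      (¬ ∃ (d : ℚ) (c : WeierstrassCurve.VariableChange ℚ), c • W₁.quadraticTwist d = W₂) →
      OnKilfordStratumAtTwo W₁ →
      ∀ (N₀ : ℕ) (Q₁ Q₂ : Finset ℕ), (∀ q ∈ Q₁, q.Prime) → (∀ q ∈ Q₂, q.Prime) → Disjoint Q₁ Q₂ →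
        (∀ q ∈ Q₁, ¬ q ∣ N₀) → (∀ q ∈ Q₂, ¬ q ∣ N₀) →
        W₁.conductorNorm ℤ = N₀ * ∏ q ∈ Q₁, q → W₂.conductorNorm ℤ = N₀ * ∏ q ∈ Q₂, q →
      ∀ (F : Type) [Field F] [NumberField F], Module.finrank ℚ F = 3 →
      ∀ e₁ e₂ : F, aeval e₁ (twoDivisionUCubic W₁) = 0 → aeval e₂ (twoDivisionUCubic W₂) = 0 →
      AlignedAtTwo F e₁ e₂ → AlignedAtInfinity F (twoDivisionUCubic W₁) (twoDivisionUCubic W₂) e₁ e₂ →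
      ∀ [NeZero (W₁.conductorNorm ℤ)] [NeZero (W₂.conductorNorm ℤ)]
        (D₁ : ModularParametrizationData W₁ (W₁.conductorNorm ℤ)) (D₂ : ModularParametrizationData W₂ (W₂.conductorNorm ℤ)),
        Odd D₁.c → Odd D₂.c →
      ∀ (L : ℕ) [NeZero L], L = W₁.conductorNorm ℤ * ∏ q ∈ Q₂, q →
      ∀ (F₁ F₂ : CuspForm (Gamma0 L) 2),
        (∀ n : ℕ, cuspCoeff F₁ n =
          ∑ T ∈ Q₂.powerset, ((∏ q ∈ T, q : ℕ) : ℂ) * (if (∏ q ∈ T, q) ∣ n then cuspCoeff D₁.f (n / ∏ q ∈ T, q) else 0)) →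
        (∀ n : ℕ, cuspCoeff F₂ n =
          ∑ T ∈ Q₁.powerset, ((∏ q ∈ T, q : ℕ) : ℂ) * (if (∏ q ∈ T, q) ∣ n then cuspCoeff D₂.f (n / ∏ q ∈ T, q) else 0)) →
      ∀ y ∈ periodHomology L,
        D₁.uniformize ((D₁.c : ℂ) * y F₁ / 2) = 0 ↔ D₂.uniformize ((D₂.c : ℂ) * y F₂ / 2) = 0) :
    ∀ (W₁ : WeierstrassCurve ℚ) [W₁.IsElliptic] [W₁.IsGloballyMinimal]
      (W₂ : WeierstrassCurve ℚ) [W₂.IsElliptic] [W₂.IsGloballyMinimal],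
      IsOrdinaryAt W₁ 2 → IsOrdinaryAt W₂ 2 →
      (∀ x : ℚ, ¬ HasRationalTwoTorsionX W₁ x) → (∀ x : ℚ, ¬ HasRationalTwoTorsionX W₂ x) →
      ¬ IsSquare W₁.Δ → ¬ IsSquare W₂.Δ →
      (¬ ∃ (d : ℚ) (c : WeierstrassCurve.VariableChange ℚ), c • W₁.quadraticTwist d = W₂) →
      OnKilfordStratumAtTwo W₁ →
      ∀ (N₀ : ℕ) (Q₁ Q₂ : Finset ℕ), (∀ q ∈ Q₁, q.Prime) → (∀ q ∈ Q₂, q.Prime) → Disjoint Q₁ Q₂ →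
        (∀ q ∈ Q₁, ¬ q ∣ N₀) → (∀ q ∈ Q₂, ¬ q ∣ N₀) →
        W₁.conductorNorm ℤ = N₀ * ∏ q ∈ Q₁, q → W₂.conductorNorm ℤ = N₀ * ∏ q ∈ Q₂, q →
      ∀ (F : Type) [Field F] [NumberField F], Module.finrank ℚ F = 3 →
      ∀ e₁ e₂ : F, aeval e₁ (twoDivisionUCubic W₁) = 0 → aeval e₂ (twoDivisionUCubic W₂) = 0 →
      AlignedAtTwo F e₁ e₂ → AlignedAtInfinity F (twoDivisionUCubic W₁) (twoDivisionUCubic W₂) e₁ e₂ →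
      ∀ [NeZero (W₁.conductorNorm ℤ)] [NeZero (W₂.conductorNorm ℤ)]
        (D₁ : ModularParametrizationData W₁ (W₁.conductorNorm ℤ)) (D₂ : ModularParametrizationData W₂ (W₂.conductorNorm ℤ)),
        Odd D₁.c → Odd D₂.c →
      ∀ (N' : ℕ) [NeZero N'], N' = W₁.conductorNorm ℤ * W₂.conductorNorm ℤ *
          ∏ ℓ ∈ (W₁.conductorNorm ℤ * W₂.conductorNorm ℤ).primeFactors.erase 2, ℓ ^ 2 →
      ∀ (g₁ g₂ : CuspForm (Gamma0 N') 2),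
        (∀ n : ℕ, cuspCoeff g₁ n =
          if ∃ ℓ ∈ (W₁.conductorNorm ℤ * W₂.conductorNorm ℤ).primeFactors.erase 2, ℓ ∣ n then 0 else cuspCoeff D₁.f n) →
        (∀ n : ℕ, cuspCoeff g₂ n =
          if ∃ ℓ ∈ (W₁.conductorNorm ℤ * W₂.conductorNorm ℤ).primeFactors.erase 2, ℓ ∣ n then 0 else cuspCoeff D₂.f n) →
      ∀ x ∈ periodHomology N',
        D₁.uniformize ((D₁.c : ℂ) *
            ((((∏ ℓ ∈ (W₁.conductorNorm ℤ * W₂.conductorNorm ℤ).primeFactors.erase 2, ℓ ^ 2 : ℕ) : ℂ) * x g₁) / 2)) = 0 ↔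
          D₂.uniformize ((D₂.c : ℂ) *
            ((((∏ ℓ ∈ (W₁.conductorNorm ℤ * W₂.conductorNorm ℤ).primeFactors.erase 2, ℓ ^ 2 : ℕ) : ℂ) * x g₂) / 2)) = 0 :=
  sameDepletedKernel_semistableShape_of_twoOldLinesPlane hPlane hKO_semistableShape

end Summit.BirchSwinnertonDyer.BirchSwinnertonDyer.Theorems.AlignedTransportAtTwoKilfordCopyCrossLevelPlaneOnly

end
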